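import Summits.RiemannHypothesis.RiemannHypothesis.Theorems.Splittings.RobinFiniteE3Cells
import HarnessLib

/-!
# Splittings — Robin finite lens, E3 (the CA Mertens certificate re-read with window hypotheses), part 4/6, §D

Cell rh-split, seat rh-split-robin-finite g7 (brief sha16 f79c5f09d8bcb036), card `run/shared/lean/pub/rh-split/cards/SPLIT-robin-finite.md` §14
(referee rh-split-ref g3 REFEREE ADDENDUM (robin, finite) §14 DELIVERABLE + REPLAY ×2 2026-08-27T05:39:31Z; lead rh-split-lead g3 RULING #24:
zero-def variant of record); cut of `HOME/rh-split-robin-finite/SketchG7-E3-zerodef.lean` (sha16 c3a3285c0daab218, 1644 l, 52 thms, ZERO defs —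
generated by the seat from SketchG7-E3.lean deb49c670b0d4cda by spelling out `ThetaWindow` / `EBoxOn` / `Eb` / `budgetPT`) into SIX files
(`RobinFiniteE3Window` §A, `…Combine` §B, `…Cells` §C, `…Large` §D, `…Error` §E, `…Main` §F; the card's five-file plan puts §A+§B in one
file, which is 428 l > the 400-line rule), filed by rh-split-typer-1 g4.  Decl blocks byte-identical to the scratch; one namespace
`…Theorems.Splittings.RobinFiniteE3` (scratch: `…Splittings.RobinFinite.E3Z`).

This part — part 4/6, §D: the large branch `P ≥ 2·10¹⁰`: `G₁ + G₂ ≥ 2.1538/(√P log P)` from the window (`G_largeW`; the tree's constant is `2.1422`).  RH-free.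

E3 of the card's exchange lemma = the MECHANICAL RE-READ of the tree's CA Mertens certificate `RobinAnalyticSharp.mertens_prod_lt_RH`
with its two RH uses replaced: (θ) Schoenfeld's `|θ t − t| ≤ √t log² t/(8π)` by a WINDOW hypothesis `∀ y ∈ [599, B], |θ y − y| ≤ √y log² y/(8π)`
(spelled out), and (f) Nicolas's `−log f(P) ≤ E_RH(P)` by an ABSTRACT error value / function, so that the tree's RH-free inputs
`RobinFiniteE1c.schoenfeldThetaOn_of_buthe2016` and `RobinFiniteTail(Free).nicolasLowerBetween_PT_tailFree` plug in (in `…Main`).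
No new analytic idea: every proof is the tree's, with `hS hRH` ↦ `hW … (t ≤ B)` and `nicolasERH_mul_le` ↦ a hypothesis.
HONEST LABEL: «SPLITTING SEARCH over kernel-typed RH-EQUIVALENCES; a splitting A ∧ B ⟹ RH is CONDITIONAL bookkeeping
unless A and B are both proved; nothing here bears on the truth of RH.»  Referee labels: class (robin, finite) UNCHANGED (RELABELLING ×4,
tail-rigid); the conditional headline's modulo-list is PRINT-ONLY {Buthe2016_thm2, Buthe2018_thm2_theta, BroadbentEtAl2021_theta_rel_1e19, RH(H₀)}.
-/

set_option linter.dupNamespace false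

noncomputable section

open Real Filter Finset
open scoped Chebyshev

namespace Summit.RiemannHypothesis.RiemannHypothesis.Theorems.Splittings.RobinFiniteE3

open Literature.NumberTheory.LFunctions
open RobinAnalyticSharp

/-! ## §D · The large branch `P ≥ 2·10¹⁰`: `G₂ + G₁ ≥ 2.1538/(√P log P)` from the window

`RobinAnalytic.key_ineq` / `RobinAnalyticRH.key_ineq_largeRH` verbatim with the window `θ`-bounds (every `θ`-point
used is `≤ P ≤ B`) and the constant raised from `2.1422` to `2.1538` (Case C quadratic with `1.1049` in place of
`1.099`: `2·0.9747·1.1049 = 2.15389…`, `0.9747·1.1049² = 1.18992…`). -/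

section LargeP
open RobinAnalytic

/-- `θ(t) ≥ 0.975 t` for `2¹⁵ ≤ t ≤ B`. -/
theorem theta_ge_975W {B t : ℝ} (hW : (∀ y : ℝ, 599 ≤ y → y ≤ B → |θ y - y| ≤ √y * Real.log y ^ 2 / (8 * π))) (ht : (2 : ℝ) ^ 15 ≤ t) (htB : t ≤ B) :
    0.975 * t ≤ θ t := by
  have h599 : (599 : ℝ) ≤ t := le_trans (by norm_num) ht
  have h1 := hW t h599 htB
  have h2 := schoenfeld_rel_le_025 ht
  have := (abs_le.1 h1).1
  linarith

/-- `θ(t) ≤ 1.025 t` for `2¹⁵ ≤ t ≤ B`. -/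
theorem theta_le_1025W {B t : ℝ} (hW : (∀ y : ℝ, 599 ≤ y → y ≤ B → |θ y - y| ≤ √y * Real.log y ^ 2 / (8 * π))) (ht : (2 : ℝ) ^ 15 ≤ t) (htB : t ≤ B) :
    θ t ≤ 1.025 * t := by
  have h599 : (599 : ℝ) ≤ t := le_trans (by norm_num) ht
  have h1 := hW t h599 htB
  have h2 := schoenfeld_rel_le_025 ht
  have := (abs_le.1 h1).2
  linarith

/-- `θ(t) ≤ 1.0002 t` for `2³⁴ ≤ t ≤ B`. -/
theorem theta_le_10002W {B t : ℝ} (hW : (∀ y : ℝ, 599 ≤ y → y ≤ B → |θ y - y| ≤ √y * Real.log y ^ 2 / (8 * π))) (ht : (2 : ℝ) ^ 34 ≤ t) (htB : t ≤ B) :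
    θ t ≤ 1.0002 * t := by
  have h599 : (599 : ℝ) ≤ t := le_trans (by norm_num) ht
  have h1 := hW t h599 htB
  have h2 := schoenfeld_rel_le_0002 ht
  have := (abs_le.1 h1).2
  linarith

/-- `θ(t) ≥ 0.9998 t` for `2³⁴ ≤ t ≤ B`. -/
theorem theta_ge_9998W {B t : ℝ} (hW : (∀ y : ℝ, 599 ≤ y → y ≤ B → |θ y - y| ≤ √y * Real.log y ^ 2 / (8 * π))) (ht : (2 : ℝ) ^ 34 ≤ t) (htB : t ≤ B) :
    0.9998 * t ≤ θ t := by
  have h599 : (599 : ℝ) ≤ t := le_trans (by norm_num) ht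
  have h1 := hW t h599 htB
  have h2 := schoenfeld_rel_le_0002 ht
  have := (abs_le.1 h1).1
  linarith

/-- `0.9998 P ≤ θ(P) ≤ 1.0002 P` for `2·10¹⁰ ≤ P ≤ B`. -/
theorem thetaP_boundsW {B : ℝ} (hW : (∀ y : ℝ, 599 ≤ y → y ≤ B → |θ y - y| ≤ √y * Real.log y ^ 2 / (8 * π))) {P : ℕ} (hP : (2 * 10 ^ 10 : ℝ) ≤ P)
    (hPB : (P : ℝ) ≤ B) : 0.9998 * P ≤ θ P ∧ θ P ≤ 1.0002 * P :=
  ⟨theta_ge_9998W hW (P_ge_2pow34 hP) hPB, theta_le_10002W hW (P_ge_2pow34 hP) hPB⟩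

/-- `window_bound` on the window (`θ` at `n ≤ 20y ≤ P ≤ B` and at `y ≤ P ≤ B`). -/
theorem window_boundW {B : ℝ} (hW : (∀ y : ℝ, 599 ≤ y → y ≤ B → |θ y - y| ≤ √y * Real.log y ^ 2 / (8 * π))) {y P Q : ℕ}
    (hy : (2 : ℝ) ^ 15 ≤ y) (hyP : 20 * y ≤ P) (hPB : (P : ℝ) ≤ B) (hQy : Q ≤ y) :
    0.827 / (y * Real.log (20 * y)) ≤
      ∑ p ∈ (Nat.primesLE P).filter (fun p => Q < p), ((p : ℝ) ^ 2)⁻¹ := by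
  classical
  have hy1R : (32768 : ℝ) ≤ y := le_trans (by norm_num) hy
  have hy1 : 32768 ≤ y := by exact_mod_cast hy1R
  have hy0 : (0 : ℝ) < y := by linarith
  set z := 20 * y with hz
  have hyz : y ≤ z := by omega
  -- restrict to the primes in `(y, z]`
  have hsub : (Nat.primesLE z).filter (fun p => y < p) ⊆ (Nat.primesLE P).filter (fun p => Q < p) := by
    intro p hp
    obtain ⟨hp1, hyp⟩ := Finset.mem_filter.1 hp
    obtain ⟨hpz, hp'⟩ := Nat.mem_primesLE.1 hp1
    exact Finset.mem_filter.2 ⟨Nat.mem_primesLE.2 ⟨hpz.trans hyP, hp'⟩, lt_of_le_of_lt hQy hyp⟩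
  refine le_trans ?_ (Finset.sum_le_sum_of_subset_of_nonneg hsub fun p _ _ => by positivity)
  refine le_trans ?_ (layer_cake y z)
  -- pointwise: `#{y < p ≤ n} ≥ (0.975 n - 1.025 y)/log z`
  have hlogz : 0 < Real.log (20 * y) := Real.log_pos (by linarith)
  have hcount : ∀ n ∈ Ioc y z,
      (0.975 * n - 1.025 * y) / Real.log (20 * y) ≤ #((Nat.primesLE n).filter (fun p => y < p)) := by
    intro n hn
    rw [Finset.mem_Ioc] at hn
    have hnR : (y : ℝ) + 1 ≤ n := by exact_mod_cast hn.1
    have hnz : (n : ℝ) ≤ 20 * y := by exact_mod_cast hn.2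
    have hn15 : (2 : ℝ) ^ 15 ≤ n := by linarith
    have h1 := theta_sub_theta_le_card_mul_log y n
    have hnB : (n : ℝ) ≤ B := le_trans (by exact_mod_cast hn.2.trans hyP) hPB
    have hyB : (y : ℝ) ≤ B := le_trans (by exact_mod_cast hyz.trans hyP) hPB
    have h2 := theta_ge_975W hW hn15 hnB
    have h3 := theta_le_1025W hW hy hyB
    have hlogn : 0 < Real.log n := Real.log_pos (by linarith)
    have hlogn' : Real.log n ≤ Real.log (20 * y) := Real.log_le_log (by linarith) hnz
    set c : ℝ := (#((Nat.primesLE n).filter (fun p => y < p)) : ℝ) with hc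
    have hc0 : 0 ≤ c := by positivity
    by_cases hneg : (0.975 : ℝ) * n - 1.025 * y ≤ 0
    · exact le_trans (div_nonpos_of_nonpos_of_nonneg hneg hlogz.le) hc0
    push Not at hneg
    rw [div_le_iff₀ hlogz]
    calc 0.975 * n - 1.025 * y ≤ θ n - θ y := by linarith
      _ ≤ c * Real.log n := h1
      _ ≤ c * Real.log (20 * y) := by gcongr
  have hd0 : ∀ n ∈ Ioc y z, 0 ≤ (1 / ((n : ℝ) * (n + 1)) - 1 / (((n : ℝ) + 1) * (n + 2))) := by
    intro n hn
    rw [Finset.mem_Ioc] at hn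
    rw [weight_eq n (by omega)]
    positivity
  calc 0.827 / (y * Real.log (20 * y))
      ≤ ∑ n ∈ Ioc y z, (1 / ((n : ℝ) * (n + 1)) - 1 / (((n : ℝ) + 1) * (n + 2))) *
          ((0.975 * n - 1.025 * y) / Real.log (20 * y)) := by
        -- evaluate the telescoping sums
        have hsum : ∑ n ∈ Ioc y z, (1 / ((n : ℝ) * (n + 1)) - 1 / (((n : ℝ) + 1) * (n + 2))) *
            ((0.975 * n - 1.025 * y) / Real.log (20 * y)) =
            (0.975 * (2 / ((y : ℝ) + 2) - 2 / ((z : ℝ) + 2)) -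
              1.025 * y * (1 / (((y : ℝ) + 1) * (y + 2)) - 1 / (((z : ℝ) + 1) * (z + 2)))) /
              Real.log (20 * y) := by
          rw [← sum_mul_weight hyz, ← sum_weight hyz, Finset.mul_sum, Finset.mul_sum,
            ← Finset.sum_sub_distrib, Finset.sum_div]
          refine Finset.sum_congr rfl fun n _ => ?_
          ring
        rw [hsum, hz]
        push_cast
        rw [show (0.827 : ℝ) / (y * Real.log (20 * y)) = 0.827 / y / Real.log (20 * y) by
          rw [div_div]]
        exact div_le_div_of_nonneg_right (bracket_ge hy1R) hlogz.le
    _ ≤ ∑ n ∈ Ioc y z, (1 / ((n : ℝ) * (n + 1)) - 1 / (((n : ℝ) + 1) * (n + 2))) *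
          #((Nat.primesLE n).filter (fun p => y < p)) := by
        refine Finset.sum_le_sum fun n hn => ?_
        exact mul_le_mul_of_nonneg_left (hcount n hn) (hd0 n hn)

/-- Case A on the window. -/
theorem gain_caseAW {B : ℝ} (hW : (∀ y : ℝ, 599 ≤ y → y ≤ B → |θ y - y| ≤ √y * Real.log y ^ 2 / (8 * π))) {P Q : ℕ}
    (hP : (2 * 10 ^ 10 : ℝ) ≤ P) (hPB : (P : ℝ) ≤ B) (hQP : Q ≤ P) (hQ : 5 * √(P : ℝ) ≤ Q) :
    2.36 / (√(P : ℝ) * Real.log P) ≤ θ Q / ((θ P + θ Q) * Real.log (θ P + θ Q)) := by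
  have hL := logP_ge hP
  have hsP := sqrtP_ge hP
  have hsq := sq_sqrtP hP
  have hP0 := P_pos hP
  obtain ⟨hθP1, hθP2⟩ := thetaP_boundsW hW hP hPB
  have hQ15 : (2 : ℝ) ^ 15 ≤ Q := by nlinarith
  have hθQ1 : 0.975 * Q ≤ θ Q :=
    theta_ge_975W hW hQ15 ((show (Q : ℝ) ≤ P by exact_mod_cast hQP).trans hPB)
  have hθQP : θ Q ≤ θ P := Chebyshev.theta_mono (by exact_mod_cast hQP)
  set R := θ P + θ Q with hR
  have hR1 : R ≤ 2.0004 * P := by linarith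
  have hRpos : 1 < R := by nlinarith
  have hlogR0 : 0 < Real.log R := Real.log_pos hRpos
  -- `log R ≤ log 2.0004 + log P ≤ 1.0293 log P`
  have hlogR : Real.log R ≤ 1.0293 * Real.log P := by
    have h1 : Real.log R ≤ Real.log (2.0004 * P) := Real.log_le_log (by linarith) hR1
    rw [Real.log_mul (by norm_num) hP0.ne'] at h1
    have h2 : Real.log (2.0004 : ℝ) ≤ 0.6934 := by
      rw [show (2.0004 : ℝ) = 2 * 1.0002 by norm_num, Real.log_mul (by norm_num) (by norm_num)]
      have := Real.log_two_lt_d9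
      have := Real.log_le_sub_one_of_pos (show (0 : ℝ) < 1.0002 by norm_num)
      linarith
    linarith
  rw [div_le_div_iff₀ (by positivity) (by positivity)]
  -- `2.36 · R log R ≤ θQ · √P log P`
  have hRlogR : R * Real.log R ≤ (2.0004 * P) * (1.0293 * Real.log P) :=
    mul_le_mul hR1 hlogR hlogR0.le (by positivity)
  have hθQ : 4.875 * √(P : ℝ) ≤ θ Q := by linarith
  calc 2.36 * ((θ P + θ Q) * Real.log (θ P + θ Q)) = 2.36 * (R * Real.log R) := by rw [hR]
    _ ≤ 2.36 * ((2.0004 * P) * (1.0293 * Real.log P)) := by gcongr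
    _ = (2.36 * 2.0004 * 1.0293) * (√(P : ℝ) * √(P : ℝ)) * Real.log P := by rw [hsq]; ring
    _ ≤ 4.875 * (√(P : ℝ) * √(P : ℝ)) * Real.log P := by gcongr; norm_num
    _ = 4.875 * √(P : ℝ) * (√(P : ℝ) * Real.log P) := by ring
    _ ≤ θ Q * (√(P : ℝ) * Real.log P) := by gcongr

/-- Case C (gain from `Q`) on the window (`Q < 5√P ≤ P ≤ B`). -/
theorem gain_caseCW {B : ℝ} (hW : (∀ y : ℝ, 599 ≤ y → y ≤ B → |θ y - y| ≤ √y * Real.log y ^ 2 / (8 * π))) {P Q : ℕ}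
    (hP : (2 * 10 ^ 10 : ℝ) ≤ P) (hPB : (P : ℝ) ≤ B) (hQlo : √(P : ℝ) / 4 < Q) (hQhi : (Q : ℝ) < 5 * √(P : ℝ)) :
    0.9747 * Q / ((P : ℝ) * Real.log P) ≤ θ Q / ((θ P + θ Q) * Real.log (θ P + θ Q)) := by
  have hL := logP_ge hP
  have hsP := sqrtP_ge hP
  have hsq := sq_sqrtP hP
  have hP0 := P_pos hP
  obtain ⟨hθP1, hθP2⟩ := thetaP_boundsW hW hP hPB
  have hQ15 : (2 : ℝ) ^ 15 ≤ Q := by nlinarith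
  have hQ0 : (0 : ℝ) < Q := by linarith
  have hQB : (Q : ℝ) ≤ B := by
    have h5 := mul_le_mul_of_nonneg_right (show (5 : ℝ) ≤ √(P : ℝ) by linarith) (Real.sqrt_nonneg (P : ℝ))
    linarith [hsq]
  have hθQ1 : 0.975 * Q ≤ θ Q := theta_ge_975W hW hQ15 hQB
  -- `θ(Q) ≤ log 4 · Q ≤ 1.3863 · 5 √P ≤ 0.0000491 P`
  have hθQ2 : θ Q ≤ 0.0000491 * P := by
    have h1 : θ Q ≤ Real.log 4 * Q := Chebyshev.theta_le_log4_mul_x hQ0.le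
    have h4 : Real.log 4 ≤ 1.3863 := by
      rw [show (4 : ℝ) = 2 ^ 2 by norm_num, Real.log_pow]
      have := Real.log_two_lt_d9
      push_cast
      linarith
    have h2 : Real.log 4 * Q ≤ 1.3863 * (5 * √(P : ℝ)) :=
      mul_le_mul h4 hQhi.le hQ0.le (by norm_num)
    -- `√P ≤ P/141421`
    have h3 : √(P : ℝ) * 141421 ≤ P :=
      calc √(P : ℝ) * 141421 ≤ √(P : ℝ) * √(P : ℝ) :=
            mul_le_mul_of_nonneg_left hsP (Real.sqrt_nonneg _)
        _ = P := hsq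
    nlinarith
  set R := θ P + θ Q with hR
  have hR1 : R ≤ 1.00025 * P := by linarith
  have hRpos : 1 < R := by nlinarith
  have hlogR0 : 0 < Real.log R := Real.log_pos hRpos
  have hlogR : Real.log R ≤ 1.0000106 * Real.log P := by
    have h1 : Real.log R ≤ Real.log (1.00025 * P) := Real.log_le_log (by linarith) hR1
    rw [Real.log_mul (by norm_num) hP0.ne'] at h1
    have h2 := Real.log_le_sub_one_of_pos (show (0 : ℝ) < 1.00025 by norm_num)
    linarith
  rw [div_le_div_iff₀ (by positivity) (by positivity)]
  have hRlogR : R * Real.log R ≤ (1.00025 * P) * (1.0000106 * Real.log P) :=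
    mul_le_mul hR1 hlogR hlogR0.le (by positivity)
  calc 0.9747 * Q * ((θ P + θ Q) * Real.log (θ P + θ Q)) = 0.9747 * Q * (R * Real.log R) := by
        rw [hR]
    _ ≤ 0.9747 * Q * ((1.00025 * P) * (1.0000106 * Real.log P)) := by gcongr
    _ = (0.9747 * 1.00025 * 1.0000106) * Q * (P * Real.log P) := by ring
    _ ≤ 0.975 * Q * (P * Real.log P) := by gcongr; norm_num
    _ ≤ θ Q * (P * Real.log P) := by gcongr

/-- Case B (window) on the window hypothesis. -/
theorem window_caseBW {B : ℝ} (hW : (∀ y : ℝ, 599 ≤ y → y ≤ B → |θ y - y| ≤ √y * Real.log y ^ 2 / (8 * π))) {P Q : ℕ}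
    (hP : (2 * 10 ^ 10 : ℝ) ≤ P) (hPB : (P : ℝ) ≤ B) (hQ : (Q : ℝ) ≤ √(P : ℝ) / 4) :
    5.8 / (√(P : ℝ) * Real.log P) ≤
      ∑ p ∈ (Nat.primesLE P).filter (fun p => Q < p), ((p : ℝ) ^ 2)⁻¹ := by
  have hL := logP_ge hP
  have hsP := sqrtP_ge hP
  have hsq := sq_sqrtP hP
  have hP0 := P_pos hP
  set y := ⌊√(P : ℝ) / 4⌋₊ with hy_def
  have hy1 : (y : ℝ) ≤ √(P : ℝ) / 4 := Nat.floor_le (by positivity)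
  have hy2 : (35355 : ℕ) ≤ y := Nat.le_floor (by push_cast; linarith)
  have hy2R : (35355 : ℝ) ≤ y := by exact_mod_cast hy2
  have hy15 : (2 : ℝ) ^ 15 ≤ y := le_trans (by norm_num) hy2R
  have hy0 : (0 : ℝ) < y := by linarith
  have hyP : 20 * y ≤ P := by
    have : (20 * y : ℝ) ≤ P := by nlinarith
    exact_mod_cast this
  have hQy : Q ≤ y := Nat.le_floor hQ
  have hw := window_boundW hW hy15 hyP hPB hQy
  refine le_trans ?_ hw
  -- `y log(20y) ≤ (√P/4)(log 5 + log P/2)`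
  have hlog20y : Real.log (20 * y) ≤ 1.6095 + Real.log P / 2 := by
    have h1 : Real.log (20 * y) ≤ Real.log (5 * √(P : ℝ)) :=
      Real.log_le_log (by positivity) (by linarith)
    have h5 : Real.log (5 * √(P : ℝ)) = Real.log 5 + Real.log P / 2 := by
      rw [Real.log_mul (by norm_num) (ne_of_gt (by positivity)), log_sqrtP hP]
    have := Real.log_five_lt_d9
    linarith
  have hlog20y0 : 0 < Real.log (20 * y) := Real.log_pos (by linarith)
  rw [div_le_div_iff₀ (by positivity) (by positivity)]
  calc 5.8 * (y * Real.log (20 * y)) ≤ 5.8 * ((√(P : ℝ) / 4) * (1.6095 + Real.log P / 2)) := by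
        gcongr
    _ ≤ 0.827 * (√(P : ℝ) * Real.log P) := by nlinarith

/-- Case C (window) on the window hypothesis. -/
theorem window_caseCW {B : ℝ} (hW : (∀ y : ℝ, 599 ≤ y → y ≤ B → |θ y - y| ≤ √y * Real.log y ^ 2 / (8 * π))) {P Q : ℕ}
    (hP : (2 * 10 ^ 10 : ℝ) ≤ P) (hPB : (P : ℝ) ≤ B) (hQlo : √(P : ℝ) / 4 < Q) (hQhi : (Q : ℝ) < 5 * √(P : ℝ)) :
    1.19 / ((Q : ℝ) * Real.log P) ≤
      ∑ p ∈ (Nat.primesLE P).filter (fun p => Q < p), ((p : ℝ) ^ 2)⁻¹ := by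
  have hL := logP_ge hP
  have hsP := sqrtP_ge hP
  have hsq := sq_sqrtP hP
  have hP0 := P_pos hP
  have hQ15 : (2 : ℝ) ^ 15 ≤ Q := by nlinarith
  have hQ0 : (0 : ℝ) < Q := by linarith
  have hQP : 20 * Q ≤ P := by
    have : (20 * Q : ℝ) ≤ P := by nlinarith
    exact_mod_cast this
  have hw := window_boundW hW hQ15 hQP hPB le_rfl
  refine le_trans ?_ hw
  have hlog20Q : Real.log (20 * Q) ≤ 4.6052 + Real.log P / 2 := by
    have h1 : Real.log (20 * Q) ≤ Real.log (100 * √(P : ℝ)) :=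
      Real.log_le_log (by positivity) (by linarith)
    have h5 : Real.log (100 * √(P : ℝ)) = Real.log 100 + Real.log P / 2 := by
      rw [Real.log_mul (by norm_num) (ne_of_gt (by positivity)), log_sqrtP hP]
    have h100 : Real.log (100 : ℝ) ≤ 4.6052 := by
      rw [show (100 : ℝ) = 10 ^ 2 by norm_num, Real.log_pow]
      have := log_ten_lt
      push_cast
      linarith
    linarith
  have hlog20Q0 : 0 < Real.log (20 * Q) := Real.log_pos (by linarith)
  rw [div_le_div_iff₀ (by positivity) (by positivity)]
  calc 1.19 * (Q * Real.log (20 * Q)) ≤ 1.19 * (Q * (4.6052 + Real.log P / 2)) := by gcongr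
    _ ≤ 0.827 * (Q * Real.log P) := by nlinarith

/-- **`G₂ + G₁ ≥ 2.1538/(√P log P)` for `2·10¹⁰ ≤ P ≤ B`, `Q ≤ P`** (cases A/B/C of `RobinAnalytic.key_ineq`,
constant `2.1538 < 2√(0.9747·1.19)`). -/
theorem G_largeW {B : ℝ} (hW : (∀ y : ℝ, 599 ≤ y → y ≤ B → |θ y - y| ≤ √y * Real.log y ^ 2 / (8 * π))) {P Q : ℕ} (hP : (2 * 10 ^ 10 : ℝ) ≤ P) (hPB : (P : ℝ) ≤ B)
    (hQP : Q ≤ P) :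
    2.1538 / (√(P : ℝ) * Real.log P) ≤
      ∑ p ∈ (Nat.primesLE P).filter (fun p => Q < p), ((p : ℝ) ^ 2)⁻¹ +
        θ Q / ((θ P + θ Q) * Real.log (θ P + θ Q)) := by
  have hL := logP_ge hP
  have hsP := sqrtP_ge hP
  have hsq := sq_sqrtP hP
  have hP0 := P_pos hP
  obtain ⟨hθP1, hθP2⟩ := thetaP_boundsW hW hP hPB
  have hden : 0 < √(P : ℝ) * Real.log P := by positivity
  set S := ∑ p ∈ (Nat.primesLE P).filter (fun p => Q < p), ((p : ℝ) ^ 2)⁻¹ with hSdef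
  set G := θ Q / ((θ P + θ Q) * Real.log (θ P + θ Q)) with hGdef
  have hS0 : 0 ≤ S := Finset.sum_nonneg fun p _ => by positivity
  have hG0 : 0 ≤ G := by
    have h1 : 0 ≤ θ Q := Chebyshev.theta_nonneg _
    have h2 : 1 < θ P + θ Q := by nlinarith
    have h3 : 0 < Real.log (θ P + θ Q) := Real.log_pos h2
    positivity
  rcases le_or_gt (5 * √(P : ℝ)) Q with hA | hA
  · -- Case A
    have := gain_caseAW hW hP hPB hQP hA
    have h2 : 2.1538 / (√(P : ℝ) * Real.log P) ≤ 2.36 / (√(P : ℝ) * Real.log P) :=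
      div_le_div_of_nonneg_right (by norm_num) hden.le
    linarith
  rcases le_or_gt (Q : ℝ) (√(P : ℝ) / 4) with hB | hB
  · -- Case B
    have := window_caseBW hW hP hPB hB
    have h2 : 2.1538 / (√(P : ℝ) * Real.log P) ≤ 5.8 / (√(P : ℝ) * Real.log P) :=
      div_le_div_of_nonneg_right (by norm_num) hden.le
    linarith
  · -- Case C
    have h1 := gain_caseCW hW hP hPB hB hA
    have h2 := window_caseCW hW hP hPB hB hA
    have hQ0 : (0 : ℝ) < Q := by
      have : (0 : ℝ) < √(P : ℝ) / 4 := by positivity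
      linarith
    have hLpos : 0 < Real.log P := by linarith
    -- `0.9747 Q/(P L) + 1.19/(Q L) ≥ 2.1538/(√P L)` : a positive-definite quadratic form
    have hs0 : 0 < √(P : ℝ) := by linarith
    have hquad : 0 ≤ 0.9747 * (Q : ℝ) ^ 2 - 2.1538 * Q * √(P : ℝ) + 1.19 * √(P : ℝ) ^ 2 := by
      nlinarith [sq_nonneg ((Q : ℝ) - 1.1049 * √(P : ℝ)), hQ0.le, hs0.le]
    have hid : (0.9747 * (Q : ℝ) ^ 2 + 1.19 * P) * √(P : ℝ) - 2.1538 * P * Q =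
        √(P : ℝ) * (0.9747 * (Q : ℝ) ^ 2 - 2.1538 * Q * √(P : ℝ) + 1.19 * √(P : ℝ) ^ 2) := by
      linear_combination (2.1538 * (Q : ℝ) - 1.19 * √(P : ℝ)) * hsq
    have hnum : 2.1538 * (P : ℝ) * Q ≤ (0.9747 * (Q : ℝ) ^ 2 + 1.19 * P) * √(P : ℝ) := by
      nlinarith [mul_nonneg hs0.le hquad]
    have key : 2.1538 / (√(P : ℝ) * Real.log P) ≤
        0.9747 * Q / ((P : ℝ) * Real.log P) + 1.19 / ((Q : ℝ) * Real.log P) := by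
      have e1 : 0.9747 * Q / ((P : ℝ) * Real.log P) + 1.19 / ((Q : ℝ) * Real.log P) =
          (0.9747 * (Q : ℝ) ^ 2 + 1.19 * P) / ((P : ℝ) * Q * Real.log P) := by
        field_simp
      rw [e1, div_le_div_iff₀ (by positivity) (by positivity)]
      nlinarith [mul_le_mul_of_nonneg_right hnum hLpos.le]
    linarith

end LargeP

end Summit.RiemannHypothesis.RiemannHypothesis.Theorems.Splittings.RobinFiniteE3

end
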